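import Mathlib
import Summits.ValiantsHypothesis.ValiantsHypothesis.Theorems.LacunarySymmetroidMatrixDescartesTieLawDegrees
import HarnessLib

/-!
# ValiantsHypothesis / LacunarySymmetroid — crux `MatrixDescartes` (stmt-ValiantsHypothesis-18050, V1), LINE (A) «product_plus_one»:
# the TIE LAW, kernel path Stage 2, part 6 — the induction on wells: theorem (i) of §45

`card_roots_MF_tieSector` — **Theorem (i) of the tie law** (pen val-idea-25 g8, HOME NOTE §45.4): for a nonempty finite set
`F` of wells with positive data whose positive roots `σ_f` are pairwise distinct, `M_F` has EXACTLY `2|F| − 1` complex roots,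
counted with multiplicity, in the open tie sector `S′`.  Induction on `F`: base `#{w·n in S′} = 1`; step `F ↦ F ∪ {f₀}` along
the weight `s = w_{f₀} ∈ (0, w_{f₀}]` of the new well (splitting identity `M = q_{f₀} M_F + s·n_{f₀} Π_F`): the count is constant
for `s > 0` (boundary lemma + `card_roots_filter_eq_of_preconnected`), and as `s → 0⁺` it equals `#{q_{f₀} in S′} + #{M_F in S′}
= 2 + (2|F| − 1)` because the two boundary roots `σ_{f₀} e^{±iπ/c}` of `q_{f₀} M_F` EXIT the closed sector (`exit_lemma`; the
velocity quotient is `σ_{f₀}/D` with `Im D < 0`, `im_boundarySum_neg`) — `card_roots_filter_eventually_eq`.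
HONEST FRAMING: helper theorem (complex count); no stub of LINE (A) is touched; `MatrixDescartes` OPEN; `VP ≠ VNP` is NOT proved.
No definitions, no named facts.
-/

set_option linter.dupNamespace false

namespace Summit.ValiantsHypothesis.ValiantsHypothesis.Theorems.LacunarySymmetroidMatrixDescartes

namespace TieLaw

open Polynomial Filter Topology

section Induction

variable {a b : ℕ}

/-- A real polynomial evaluated at a conjugate (file-local copy; cf. `…TieLawBoundarySum`). -/
private theorem eval_map_conj' (p : ℝ[X]) (z : ℂ) :
    (p.map (algebraMap ℝ ℂ)).eval ((starRingEnd ℂ) z) = (starRingEnd ℂ) ((p.map (algebraMap ℝ ℂ)).eval z) := by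
  rw [eval_map, eval_map, hom_eval₂]
  congr 1
  ext x
  simp

/-- `M_{{f₀}} = w_{f₀} · n_{f₀}`. -/
theorem MF_singleton {ι : Type*} [DecidableEq ι] (a b : ℕ) (f₀ : ι) (β γ w : ι → ℝ) :
    MF a b {f₀} β γ w = C (w f₀) * nPoly a b (a + b) (β f₀) (γ f₀) := by
  unfold MF
  rw [Finset.sum_singleton, Finset.erase_singleton, Finset.prod_empty, mul_one]

/-- The derivative of `g` over `ℂ` at a real point is the cast of the real derivative. -/
theorem map_gPoly_derivative_eval_ofReal (a c : ℕ) (β γ t : ℝ) :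
    ((gPoly a c β γ).map (algebraMap ℝ ℂ)).derivative.eval (t : ℂ) =
      (((gPoly a c β γ).derivative.eval t : ℝ) : ℂ) := by
  rw [derivative_map, eval_map, ← Complex.coe_algebraMap, eval₂_at_apply]

/-- `σ g′(σ) = cγσ^c + aσ^a` for the trinomial (`0 < a ≤ c`... here only `0 < a`, `0 < c`). -/
theorem mul_gPoly_derivative_eval (ha : 0 < a) {c : ℕ} (hc : 0 < c) (β γ t : ℝ) :
    t * (gPoly a c β γ).derivative.eval t = c * γ * t ^ c + a * t ^ a := by
  simp only [gPoly, derivative_add, derivative_sub, derivative_C_mul, derivative_X_pow, derivative_C, sub_zero,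
    eval_add, eval_mul, eval_C, eval_pow, eval_X]
  have h1 : t * t ^ (c - 1) = t ^ c := by rw [← pow_succ', Nat.sub_add_cancel hc]
  have h2 : t * t ^ (a - 1) = t ^ a := by rw [← pow_succ', Nat.sub_add_cancel ha]
  calc t * (γ * (↑c * t ^ (c - 1)) + ↑a * t ^ (a - 1))
      = γ * c * (t * t ^ (c - 1)) + a * (t * t ^ (a - 1)) := by ring
    _ = c * γ * t ^ c + a * t ^ a := by rw [h1, h2]; ring

open Classical in
/-- **Theorem (i) of the tie law (§45.4).**  For `0 < a < b`, `c = a + b`, a nonempty finite set `F` of wells `(β_f, γ_f)` with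
positive weights `w_f`, positive data, and pairwise distinct positive roots `σ_f` of `g_f = γ_f X^c + X^a − β_f`, the polynomial
`M_F` has exactly `2|F| − 1` complex roots, counted with multiplicity, in the open tie sector `S′ = {|arg x| < π/c}`. -/
theorem card_roots_MF_tieSector {ι : Type*} [DecidableEq ι] (ha : 0 < a) (hab : a < b) (F : Finset ι) (hF : F.Nonempty)
    (β γ w σ : ι → ℝ) (hβ : ∀ f ∈ F, 0 < β f) (hγ : ∀ f ∈ F, 0 < γ f) (hw : ∀ f ∈ F, 0 < w f)
    (hσ : ∀ f ∈ F, 0 < σ f) (hroot : ∀ f ∈ F, (gPoly a (a + b) (β f) (γ f)).eval (σ f) = 0) (hinj : Set.InjOn σ F) :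
    ((((MF a b F β γ w).map (algebraMap ℝ ℂ)).roots.filter (· ∈ tieSector (a + b))).card) = 2 * F.card - 1 := by
  induction hF using Finset.Nonempty.cons_induction with
  | singleton f₀ =>
    rw [MF_singleton, Finset.card_singleton]
    exact card_roots_single_tieSector ha hab (hβ f₀ (Finset.mem_singleton_self _))
      (hγ f₀ (Finset.mem_singleton_self _)) (hw f₀ (Finset.mem_singleton_self _))
  | cons f₀ F' hf₀ hF' ih =>
    -- data on F' and at f₀
    have hmem : ∀ f ∈ F', f ∈ Finset.cons f₀ F' hf₀ := fun f hf => Finset.mem_cons.2 (Or.inr hf)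
    have hm₀ : f₀ ∈ Finset.cons f₀ F' hf₀ := Finset.mem_cons_self _ _
    have ih' := ih (fun f hf => hβ f (hmem f hf)) (fun f hf => hγ f (hmem f hf)) (fun f hf => hw f (hmem f hf))
      (fun f hf => hσ f (hmem f hf)) (fun f hf => hroot f (hmem f hf)) (fun f hf g hg h => hinj (hmem f hf) (hmem g hg) h)
    have hβ₀ := hβ f₀ hm₀
    have hγ₀ := hγ f₀ hm₀
    have hw₀ := hw f₀ hm₀
    have hσ₀ := hσ f₀ hm₀
    have hroot₀ := hroot f₀ hm₀
    set c := a + b with hc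
    have hc0 : c ≠ 0 := by omega
    have hcpos : 0 < c := by omega
    have hac : a < c := by omega
    have h2a : 2 * a < c := by omega
    have hc2 : 2 < c := by omega
    -- the real objects
    set q₀ := qPoly a c (β f₀) (γ f₀) with hq₀
    set n₀ := nPoly a b c (β f₀) (γ f₀) with hn₀
    set M' := MF a b F' β γ w with hM'
    set Pq := ∏ f ∈ F', qPoly a c (β f) (γ f) with hPq
    set Q : ℝ → ℝ[X] := fun s => q₀ * M' + C s * (n₀ * Pq) with hQ
    have hQMF : ∀ s, Q s = MF a b (Finset.cons f₀ F' hf₀) β γ (Function.update w f₀ s) := by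
      intro s
      rw [MF_cons, Function.update_self, MF_congr_weights a b F' β γ (Function.update w f₀ s) w
        (fun f hf => Function.update_of_ne (ne_of_mem_of_not_mem hf hf₀) _ _)]
      simp only [hQ]
      ring
    have hQw : Q (w f₀) = MF a b (Finset.cons f₀ F' hf₀) β γ w := by
      rw [hQMF, Function.update_eq_self]
    -- the complex family
    set A := (q₀ * M').map (algebraMap ℝ ℂ) with hA
    set B := (n₀ * Pq).map (algebraMap ℝ ℂ) with hB
    set P : ℝ → ℂ[X] := fun s => A + C (s : ℂ) * B with hP
    have hPQ : ∀ s, P s = (Q s).map (algebraMap ℝ ℂ) := by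
      intro s
      simp only [hP, hQ, hA, hB, Polynomial.map_add, Polynomial.map_mul, map_C, Complex.coe_algebraMap]
    -- degrees
    set N := c * (2 * (Finset.cons f₀ F' hf₀).card - 1) with hN
    have hcard : (Finset.cons f₀ F' hf₀).card = F'.card + 1 := Finset.card_cons hf₀
    have hF'pos : 0 < F'.card := Finset.card_pos.2 hF'
    obtain ⟨m, hm⟩ := Nat.exists_eq_succ_of_ne_zero hF'pos.ne'
    have hN1 : N = 2 * c + c * (2 * F'.card - 1) := by
      rw [hN, hcard, hm, Nat.succ_eq_add_one, show 2 * (m + 1 + 1) - 1 = 2 * m + 3 by omega,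
        show 2 * (m + 1) - 1 = 2 * m + 1 by omega]
      ring
    have hN2 : N = c + F'.card * (2 * c) := by
      rw [hN, hcard, hm, Nat.succ_eq_add_one, show 2 * (m + 1 + 1) - 1 = 2 * m + 3 by omega]
      ring
    have hdegQ : ∀ s, (Q s).natDegree ≤ N := fun s => by
      rw [hQMF]
      exact natDegree_MF_le hab _ β γ _
    have hdeg : ∀ s, (P s).natDegree ≤ N := fun s => by
      rw [hPQ]
      exact (natDegree_map_le).trans (hdegQ s)
    have hAtop : (q₀ * M').coeff N = γ f₀ ^ 2 * M'.coeff (c * (2 * F'.card - 1)) := by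
      rw [hN1, coeff_mul_add_eq_of_natDegree_le (natDegree_qPoly_le hac _ _) (natDegree_MF_le hab F' β γ w),
        coeff_qPoly_top hac]
    have hBtop : (n₀ * Pq).coeff N = (b * γ f₀) * ∏ f ∈ F', γ f ^ 2 := by
      rw [hN2, coeff_mul_add_eq_of_natDegree_le (natDegree_nPoly_le _ _ _ _ _)
        (natDegree_prod_le_of_le _ _ _ fun f _ => natDegree_qPoly_le hac _ _), coeff_nPoly_top hc0,
        coeff_prod_of_natDegree_le _ _ _ (fun f _ => natDegree_qPoly_le hac _ _)]
      congr 1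
      exact Finset.prod_congr rfl fun f _ => coeff_qPoly_top hac _ _
    have hApos : 0 < (q₀ * M').coeff N := by
      rw [hAtop]
      exact mul_pos (pow_pos hγ₀ 2) (coeff_MF_top_pos hab F' hF' β γ w (fun f hf => hγ f (hmem f hf))
        (fun f hf => hw f (hmem f hf)))
    have hBpos : 0 < (n₀ * Pq).coeff N := by
      rw [hBtop]
      have hb : (0 : ℝ) < b := by exact_mod_cast (show 0 < b by omega)
      exact mul_pos (mul_pos hb hγ₀) (Finset.prod_pos fun f hf => pow_pos (hγ f (hmem f hf)) 2)
    have htop : ∀ s : ℝ, 0 ≤ s → (P s).coeff N ≠ 0 := by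
      intro s hs
      rw [hPQ, coeff_map]
      have : 0 < (Q s).coeff N := by
        simp only [hQ, coeff_add, coeff_C_mul]
        nlinarith
      simp only [Complex.coe_algebraMap, ne_eq, Complex.ofReal_eq_zero]
      exact this.ne'
    have hcont : ∀ k, Continuous fun s : ℝ => (P s).coeff k := fun k => by
      simp only [hP, coeff_add, coeff_C_mul]
      fun_prop
    -- (S1) for s > 0 all roots lie in S′ ∪ E
    have hrootsU : ∀ s ∈ Set.Ioi (0 : ℝ), ∀ z ∈ (P s).roots, z ∈ tieSector c ∪ tieExterior c := by
      intro s hs z hz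
      rw [hPQ, hQMF] at hz
      refine roots_MF_subset ha hab _ ⟨f₀, hm₀⟩ β γ (Function.update w f₀ s) σ hβ hγ ?_ hσ hroot hinj z hz
      intro f hf
      rcases Finset.mem_cons.1 hf with rfl | hf
      · rw [Function.update_self]; exact hs
      · rw [Function.update_of_ne (ne_of_mem_of_not_mem hf hf₀)]; exact hw f (hmem f hf)
    -- the point xp = σ₀ ω and the quantities there
    set σ₀ := σ f₀ with hσ₀def
    set xp := (σ₀ : ℂ) * rot (Real.pi / c) with hx
    set K := rot (Real.pi / c) ^ a - rot (-(Real.pi / c)) ^ a with hK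
    have hK0 : K ≠ 0 := rot_pow_sub_rot_neg_pow_ne_zero ha hac
    have hω0 : rot (Real.pi / c) ≠ 0 := rot_ne_zero _
    have hωω : rot (Real.pi / c) * rot (-(Real.pi / c)) = 1 := rot_mul_rot_neg _
    have hx0 : xp ≠ 0 := mul_ne_zero (by exact_mod_cast hσ₀.ne') hω0
    have hKx : K * xp ^ a ≠ 0 := mul_ne_zero hK0 (pow_ne_zero _ hx0)
    -- g_f(σ₀) ≠ 0 on F'
    have hRF' : ∀ f ∈ F', (gPoly a c (β f) (γ f)).eval σ₀ ≠ 0 := by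
      intro f hf h0
      have e := gPoly_root_unique (hγ f (hmem f hf)) hσ₀ (hσ f (hmem f hf)) h0 (hroot f (hmem f hf)) ha
      exact hf₀ ((hinj hm₀ (hmem f hf) e) ▸ hf)
    set G := ((gPoly a c (β f₀) (γ f₀)).map (algebraMap ℝ ℂ)).eval ((σ₀ : ℂ) * rot (2 * Real.pi / c)) with hG
    have hG0 : G ≠ 0 := map_gPoly_eval_ray_ne_zero ha h2a _ _ hσ₀
    set g' := (gPoly a c (β f₀) (γ f₀)).derivative.eval σ₀ with hg'
    have hg'pos : 0 < g' := gFam_derivative_eval_pos hcpos hγ₀ zero_le_one (β f₀) hσ₀ |>.trans_eq (by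
      rw [hg', gPoly, C_1, one_mul])
    have hg'0 : (g' : ℂ) ≠ 0 := by exact_mod_cast hg'pos.ne'
    set Mx := (M'.map (algebraMap ℝ ℂ)).eval xp with hMx
    have hMx0 : Mx ≠ 0 := MF_eval_upper_ray_ne_zero ha hab F' hF' β γ w σ (fun f hf => hβ f (hmem f hf))
      (fun f hf => hγ f (hmem f hf)) (fun f hf => hw f (hmem f hf)) (fun f hf => hσ f (hmem f hf))
      (fun f hf => hroot f (hmem f hf)) (fun f hf g hg h => hinj (hmem f hf) (hmem g hg) h) hσ₀
    set Pqx := (Pq.map (algebraMap ℝ ℂ)).eval xp with hPqx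
    have hPqx_eq : Pqx = ∏ f ∈ F', (((gPoly a c (β f) (γ f)).map (algebraMap ℝ ℂ)).eval ((σ₀ : ℂ) * rot (2 * Real.pi / c)) *
        ((((gPoly a c (β f) (γ f)).eval σ₀ : ℝ)) : ℂ)) := by
      rw [hPqx, hPq, Polynomial.map_prod, eval_prod]
      exact Finset.prod_congr rfl fun f _ => map_qPoly_eval_ray hc0 a (β f) (γ f) σ₀
    have hPqx0 : Pqx ≠ 0 := by
      rw [hPqx_eq]
      exact Finset.prod_ne_zero_iff.2 fun f hf =>
        mul_ne_zero (map_gPoly_eval_ray_ne_zero ha h2a _ _ hσ₀) (by exact_mod_cast hRF' f hf)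
    set nx := (n₀.map (algebraMap ℝ ℂ)).eval xp with hnx
    set D := ∑ f ∈ F', (w f : ℂ) *
        ((((c : ℕ) : ℂ) * γ f * ((σ₀ : ℂ) * rot (2 * Real.pi / c)) ^ c + a * ((σ₀ : ℂ) * rot (2 * Real.pi / c)) ^ a) /
            ((gPoly a c (β f) (γ f)).map (algebraMap ℝ ℂ)).eval ((σ₀ : ℂ) * rot (2 * Real.pi / c)) -
          ((((c : ℕ) * γ f * σ₀ ^ c + a * σ₀ ^ a : ℝ)) : ℂ) / ((((gPoly a c (β f) (γ f)).eval σ₀ : ℝ)) : ℂ)) with hD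
    have hDim : D.im < 0 := im_boundarySum_neg hab F' hF' β γ w (fun f hf => hβ f (hmem f hf))
      (fun f hf => hγ f (hmem f hf)) (fun f hf => hw f (hmem f hf)) ha hσ₀
    have hD0 : D ≠ 0 := fun h => by rw [h, Complex.zero_im] at hDim; exact lt_irrefl _ hDim
    -- (★) K xp^a Mx = Pqx D  and  (★★) K xp^a nx = -V₀ G
    have hMM : K * xp ^ a * Mx = Pqx * D := by
      rw [hPqx_eq]
      exact MF_ray_identity hab F' β γ w σ₀ hRF' ha hσ₀
    set V₀ : ℝ := c * γ f₀ * σ₀ ^ c + a * σ₀ ^ a with hV₀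
    have hnn : K * xp ^ a * nx = -((V₀ : ℂ) * G) := by
      have h := ray_I2 hc ha (β f₀) (γ f₀) σ₀
      rw [hroot₀] at h
      simp only [Complex.ofReal_zero, mul_zero, zero_sub] at h
      rw [hnx, hn₀, h]
    have hV : (V₀ : ℂ) = (σ₀ : ℂ) * g' := by
      rw [hV₀, hg', ← Complex.ofReal_mul, mul_gPoly_derivative_eval ha hcpos]
    -- A, B at xp
    have hq0x : (q₀.map (algebraMap ℝ ℂ)).eval xp = 0 := by
      rw [hq₀, map_qPoly_eval_ray hc0, hroot₀]
      simp
    have hAx : A.IsRoot xp := by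
      rw [IsRoot, hA, Polynomial.map_mul, eval_mul, hq0x, zero_mul]
    have hBx : B.eval xp = nx * Pqx := by
      rw [hB, Polynomial.map_mul, eval_mul]
    have hA'x : A.derivative.eval xp = G * rot (-(Real.pi / c)) * g' * Mx := by
      set gC := (gPoly a c (β f₀) (γ f₀)).map (algebraMap ℝ ℂ) with hgC
      have e1 : (gC.comp (C (rot (Real.pi / c)) * X)).eval xp = G := by
        rw [eval_comp, eval_mul, eval_C, eval_X, hx, omega_mul_ray]
      have e2 : (gC.comp (C (rot (-(Real.pi / c))) * X)).eval xp = 0 := by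
        rw [eval_comp, eval_mul, eval_C, eval_X, hx, omegaBar_mul_ray, hgC, map_gPoly_eval_ofReal, hroot₀,
          Complex.ofReal_zero]
      have e3 : (derivative (gC.comp (C (rot (-(Real.pi / c))) * X))).eval xp = rot (-(Real.pi / c)) * g' := by
        rw [derivative_comp, derivative_C_mul_X, eval_mul, eval_C, eval_comp, eval_mul, eval_C, eval_X, hx,
          omegaBar_mul_ray, hgC, map_gPoly_derivative_eval_ofReal]
      have hqder : (q₀.map (algebraMap ℝ ℂ)).derivative.eval xp = G * rot (-(Real.pi / c)) * g' := by
        rw [hq₀, map_qPoly_eq hc0, ← hgC, derivative_mul, eval_add, eval_mul, eval_mul, e1, e2, e3]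
        ring
      rw [hA, Polynomial.map_mul, derivative_mul, eval_add, eval_mul, eval_mul, hq0x, zero_mul, add_zero, hqder]
    have hA'0 : A.derivative.eval xp ≠ 0 := by
      rw [hA'x]
      exact mul_ne_zero (mul_ne_zero (mul_ne_zero hG0 (rot_ne_zero _)) hg'0) hMx0
    -- the velocity quotient is σ₀ / D
    have hE : -(B.eval xp / A.derivative.eval xp) / rot (Real.pi / c) = (σ₀ : ℂ) / D := by
      rw [hBx, hA'x, neg_div, div_div, neg_div', div_eq_div_iff (by
        exact mul_ne_zero (mul_ne_zero (mul_ne_zero (mul_ne_zero hG0 (rot_ne_zero _)) hg'0) hMx0) hω0) hD0]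
      apply mul_left_cancel₀ hKx
      linear_combination (-(Pqx * D)) * hnn + (-((σ₀ : ℂ) * G * rot (-(Real.pi / c)) * g' * rot (Real.pi / c))) * hMM +
        (G * Pqx * D) * hV + (-((σ₀ : ℂ) * (g' : ℂ) * G * Pqx * D)) * hωω
    have hv : 0 < (-(B.eval xp / A.derivative.eval xp) / rot (Real.pi / c)).im := by
      rw [hE, div_eq_mul_inv, Complex.im_ofReal_mul, Complex.inv_im]
      have hns : 0 < Complex.normSq D := Complex.normSq_pos.2 hD0
      have : 0 < -D.im / Complex.normSq D := div_pos (by linarith) hns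
      exact mul_pos hσ₀ this
    obtain ⟨ρ, hρ, hexit⟩ := exit_lemma (B := B) hAx hA'0 hω0 hv
    -- (S3) side information at s = 0
    have hP0 : P 0 = A := by simp [hP]
    have hq0ne : q₀.map (algebraMap ℝ ℂ) ≠ 0 := by
      rw [hq₀, map_qPoly_eq hc0]
      exact mul_ne_zero
        (fun h => map_gPoly_ne_zero hac (β f₀) hγ₀.ne' (comp_eq_zero_iff.1 h |>.resolve_right (by simp [rot_ne_zero])))
        (fun h => map_gPoly_ne_zero hac (β f₀) hγ₀.ne' (comp_eq_zero_iff.1 h |>.resolve_right (by simp [rot_ne_zero])))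
    have hM'ne : M'.map (algebraMap ℝ ℂ) ≠ 0 := by
      refine (Polynomial.map_ne_zero_iff (algebraMap ℝ ℂ).injective).2 fun h => ?_
      have := MF_eval_zero_neg (b := b) ha F' hF' β γ w (fun f hf => hβ f (hmem f hf)) (fun f hf => hw f (hmem f hf))
      rw [← hM', h, eval_zero] at this
      exact lt_irrefl _ this
    have hAne : A ≠ 0 := by rw [hA, Polynomial.map_mul]; exact mul_ne_zero hq0ne hM'ne
    -- roots of P s are closed under conjugation (real family)
    have hconj : ∀ s : ℝ, ∀ u ∈ (P s).roots, (starRingEnd ℂ) u ∈ (P s).roots := by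
      intro s u hu
      have hPs0 : P s ≠ 0 := fun h => by rw [h, roots_zero] at hu; exact Multiset.notMem_zero _ hu
      rw [mem_roots hPs0, IsRoot.def] at hu ⊢
      rw [hPQ] at hu ⊢
      rw [eval_map_conj', hu, map_zero]
    have hside0 : ∀ z ∈ (P 0).roots, ∃ ρ' : ℝ, 0 < ρ' ∧ ∀ᶠ s in 𝓝[>] (0 : ℝ),
        ∀ u ∈ (P s).roots, ‖u - z‖ < ρ' → (u ∈ tieSector c ↔ z ∈ tieSector c) := by
      intro z hz
      by_cases h1 : z ∈ tieSector c
      · exact side_of_isOpen P (isOpen_tieSector c) h1 fun u hu => by simp [hu, h1]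
      by_cases h2 : z ∈ tieExterior c
      · exact side_of_isOpen P (isOpen_tieExterior c) h2 fun u hu => by
          simp [not_mem_tieSector_of_mem_tieExterior hu, h1]
      -- boundary root: z = xp or its conjugate
      rw [hP0] at hz
      have hzroot := (mem_roots hAne).1 hz
      have hz0 : z ≠ 0 := by
        rintro rfl
        rw [IsRoot.def, hA, Polynomial.map_mul, eval_mul, mul_eq_zero] at hzroot
        rcases hzroot with h | h
        · rw [hq₀, eval_map, show (0 : ℂ) = algebraMap ℝ ℂ 0 from (map_zero _).symm, eval₂_at_apply] at h
          have h00 := (algebraMap ℝ ℂ).injective h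
          have : (qPoly a c (β f₀) (γ f₀)).eval 0 = β f₀ ^ 2 := by
            simp only [qPoly, mPoly, eval_add, eval_sub, eval_mul, eval_pow, eval_C, eval_X, zero_pow hc0,
              zero_pow ha.ne', zero_pow (show 2 * a ≠ 0 by omega), mul_zero, add_zero, zero_mul, sub_zero]
          rw [this] at h00
          exact absurd h00 (pow_ne_zero 2 hβ₀.ne')
        · have hneg := MF_eval_zero_neg (b := b) ha F' hF' β γ w (fun f hf => hβ f (hmem f hf))
            (fun f hf => hw f (hmem f hf))
          rw [hM', eval_map, show (0 : ℂ) = algebraMap ℝ ℂ 0 from (map_zero _).symm, eval₂_at_apply] at h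
          have h00 := (algebraMap ℝ ℂ).injective h
          rw [h00] at hneg
          exact lt_irrefl _ hneg
      obtain ⟨t, ht, hzt⟩ := eq_ray_of_not_mem_tie hc2 h1 h2 hz0
      -- M' has no root on the rays, so z is a root of q₀, hence t = σ₀
      have hzq : (q₀.map (algebraMap ℝ ℂ)).eval z = 0 := by
        rw [IsRoot.def, hA, Polynomial.map_mul, eval_mul, mul_eq_zero] at hzroot
        rcases hzroot with h | h
        · exact h
        · exfalso
          rcases hzt with hzt | hzt
          · exact MF_eval_upper_ray_ne_zero ha hab F' hF' β γ w σ (fun f hf => hβ f (hmem f hf))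
              (fun f hf => hγ f (hmem f hf)) (fun f hf => hw f (hmem f hf)) (fun f hf => hσ f (hmem f hf))
              (fun f hf => hroot f (hmem f hf)) (fun f hf g hg h => hinj (hmem f hf) (hmem g hg) h) ht
              (by rw [← hM', ← hzt]; exact h)
          · exact MF_eval_lower_ray_ne_zero ha hab F' hF' β γ w σ (fun f hf => hβ f (hmem f hf))
              (fun f hf => hγ f (hmem f hf)) (fun f hf => hw f (hmem f hf)) (fun f hf => hσ f (hmem f hf))
              (fun f hf => hroot f (hmem f hf)) (fun f hf g hg h => hinj (hmem f hf) (hmem g hg) h) ht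
              (by rw [← hM', ← hzt]; exact h)
      have htσ : t = σ₀ := by
        have hqt : (q₀.map (algebraMap ℝ ℂ)).eval ((t : ℂ) * rot (Real.pi / c)) = 0 := by
          rcases hzt with hzt | hzt
          · rw [← hzt]; exact hzq
          · have : (t : ℂ) * rot (Real.pi / c) = (starRingEnd ℂ) z := by
              rw [hzt, map_mul, Complex.conj_ofReal, conj_rot, neg_neg]
            rw [this, hq₀, eval_map_conj', ← hq₀, hzq, map_zero]
        rw [hq₀, map_qPoly_eval_ray hc0, mul_eq_zero] at hqt
        rcases hqt with h | h
        · exact absurd h (map_gPoly_eval_ray_ne_zero ha h2a _ _ ht)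
        · exact gPoly_root_unique hγ₀ ht hσ₀ (by exact_mod_cast h) hroot₀ ha
      subst htσ
      refine ⟨ρ, hρ, hexit.mono fun s hs u hu huz => ?_⟩
      have hxS : xp ∉ tieSector c := fun h => by
        rw [mem_tieSector] at h
        have h2 := h.2
        rw [hx, mul_assoc, hωω, mul_one, Complex.ofReal_im] at h2
        exact lt_irrefl _ h2
      rcases hzt with hzt | hzt
      · -- u near xp: Im(u ω̄) > 0, so u ∉ S′
        have hux : ‖u - xp‖ < ρ := by rw [hx]; rw [hzt] at huz; exact huz
        have him := hs u hu hux
        have e : (u - xp) / rot (Real.pi / c) = u * rot (-(Real.pi / c)) - (σ f₀ : ℂ) := by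
          rw [div_eq_mul_inv, (eq_inv_of_mul_eq_one_right hωω).symm, sub_mul, hx, mul_assoc, hωω, mul_one]
        rw [e, Complex.sub_im, Complex.ofReal_im, sub_zero] at him
        have huS : u ∉ tieSector c := fun h => by
          rw [mem_tieSector] at h
          linarith [h.2]
        rw [hzt]
        exact iff_of_false huS hxS
      · -- u near conj xp: conj u near xp
        have hux : ‖(starRingEnd ℂ) u - xp‖ < ρ := by
          have : (starRingEnd ℂ) u - xp = (starRingEnd ℂ) (u - z) := by
            rw [map_sub, hzt, map_mul, Complex.conj_ofReal, conj_rot, neg_neg]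
          rw [this, Complex.norm_conj]
          exact huz
        have him := hs _ (hconj s u hu) hux
        have e : ((starRingEnd ℂ) u - xp) / rot (Real.pi / c) =
            (starRingEnd ℂ) (u * rot (Real.pi / c)) - (σ f₀ : ℂ) := by
          rw [div_eq_mul_inv, (eq_inv_of_mul_eq_one_right hωω).symm, sub_mul, hx, mul_assoc, hωω, mul_one,
            map_mul, conj_rot]
        rw [e, Complex.sub_im, Complex.ofReal_im, sub_zero, Complex.conj_im] at him
        have huS : u ∉ tieSector c := fun h => by
          rw [mem_tieSector] at h
          linarith [h.1]
        exact iff_of_false huS h1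
    -- (S4) the count near 0⁺
    have hcount0 : ∀ᶠ s in 𝓝[>] (0 : ℝ), ((P s).roots.filter (· ∈ tieSector c)).card = 2 * F'.card + 1 := by
      have h := card_roots_filter_eventually_eq (l := 𝓝[>] (0 : ℝ)) nhdsWithin_le_nhds hdeg (htop 0 le_rfl)
        (fun k => (hcont k).continuousAt) (tieSector c) (· ∈ tieSector c) hside0
      refine h.mono fun s hs => hs.trans ?_
      rw [hP0, hA, Polynomial.map_mul, roots_mul (mul_ne_zero hq0ne hM'ne), Multiset.filter_add, Multiset.card_add,
        hq₀, card_roots_qPoly_tieSector ha hab hβ₀ hγ₀, hM', ih']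
      omega
    -- (S5) constancy on (0, ∞) up to s = w f₀
    obtain ⟨s₁, hs₁count, hs₁pos⟩ := (hcount0.and self_mem_nhdsWithin).exists
    have hconst := card_roots_filter_eq_of_preconnected hdeg hcont isPreconnected_Ioi
      (fun s hs => htop s (le_of_lt hs)) (isOpen_tieSector c) (isOpen_tieExterior c)
      (disjoint_tieSector_tieExterior c) hrootsU hs₁pos (Set.mem_Ioi.2 hw₀)
    rw [← hQw, ← hPQ, ← hconst, hs₁count, hcard]
    omega

end Induction

end TieLaw

end Summit.ValiantsHypothesis.ValiantsHypothesis.Theorems.LacunarySymmetroidMatrixDescartes
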